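import Mathlib
import Summits.NavierStokesRegularity.NavierStokesRegularity.Theses.WeakLambdaEndpoint
import Summits.NavierStokesRegularity.NavierStokesRegularity.Theorems.TypeICertificateLadderNoBlowupToClay
import HarnessLib

/-!
# `WeakLambdaEndpoint.Assembly` — the route's assembly
  (item stmt-NavierStokesRegularity-19627; pure logic)

**Statement.** `WeakLambdaApriori → WeakLambdaCriterion → NavierStokesRegularity`.

PROOF (the planner's three lines over the proved no-blow-up ⇒ Clay theorem). `WeakLambdaCriterion`
supplies `c₀ > 0` and the continuation criterion under the weak-`L^{5/2}` bound on `Λ_{c₀}`;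
`WeakLambdaApriori` at that `c₀` supplies the bound for every classical Leray–Hopf solution from a
rapidly decaying datum; hence every such solution extends smoothly past every `T`, and the landed
`typeICertificateLadder_noBlowupToClay_proof` (item stmt-NavierStokesRegularity-0055,
`Theorems/TypeICertificateLadderNoBlowupToClay.lean`) turns no-blow-up into Clay (A).  (The route
file's own `closes` takes `Assembly` as a hypothesis, so it cannot be used here.)

HONEST FRAMING: glue between the route's own statements (about HYPOTHETICAL objects); nothing
here bears on the regularity problem itself.
-/

noncomputable section

set_option linter.dupNamespace false

namespace Summit.NavierStokesRegularity.NavierStokesRegularity.Theorems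

/-- **Item stmt-NavierStokesRegularity-19627** (`WeakLambdaEndpoint.Assembly`): the a-priori
weak-`L^{5/2}` bound on `Λ_{c₀}` and the criterion at the same `c₀` give no blow-up, and the landed
no-blow-up ⇒ Clay theorem concludes. [this file] -/
theorem weakLambdaEndpoint_assembly_proof :
    Summit.NavierStokesRegularity.NavierStokesRegularity.Theses.WeakLambdaEndpoint.Assembly := by
  unfold Summit.NavierStokesRegularity.NavierStokesRegularity.Theses.WeakLambdaEndpoint.Assembly
    Summit.NavierStokesRegularity.NavierStokesRegularity.Theses.WeakLambdaEndpoint.WeakLambdaApriori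
    Summit.NavierStokesRegularity.NavierStokesRegularity.Theses.WeakLambdaEndpoint.WeakLambdaCriterion
  intro h₀ h₁
  obtain ⟨c₀, hc₀, hcrit⟩ := h₁
  exact typeICertificateLadder_noBlowupToClay_proof fun ν T hν hT u p hcl hLH hdec =>
    hcrit ν T hν hT u p hcl hLH hdec (h₀ c₀ hc₀ ν T hν hT u p hcl hLH hdec)

end Summit.NavierStokesRegularity.NavierStokesRegularity.Theorems

end
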